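import Summits.ResolutionOfSingularities.ResolutionOfSingularities.Theorems.FrobeniusLadderFInjectiveMacaulayficationNewtonChartLemma
import HarnessLib

/-!
# (W-ND)⁺ «TJURINA UPGRADE» (A): Ishii's chart Lemma 4.4.24 needs only WEAK (Tjurina) non-degeneracy — the `z^p` vertex is harmless
# (crux `FInjectiveMacaulayfication` stmt-ResolutionOfSingularities-15315, chain w45a; seat res-L1-w45a-stub-3 g11, FINDING + OFFER STATUS 18:02Z; twin-by-callee-swap of
# res-L1-w45a-stub-1's ✓ p651264 `NewtonChartLemma.ishii_lemma_4_4_24`, whose proof already derives `f_F(x) = 0` (Ishii (4.13)) before contradicting non-degeneracy)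

[OURS · L1 W4.5a] Support file (`--supports stmt-ResolutionOfSingularities-15315 --as helper`); def-free; UNCONDITIONAL; no named fact. NOT a statement of any manuscript.
AI-written (AI review is weaker than expert review).

WHY. Boubakri–Greuel–Markwig distinguish `NND` (tree `IsNewtonNondegenerate`: the JACOBIAN ideal of every initial form `In_w f`, `w > 0`, has no zero in the torus) from
`WND` along `w` (tree `IsWeaklyNondegenerateAlong w`: the TJURINA ideal `(In_w f, ∂ In_w f)` has no zero in the torus). In characteristic `0` they agree on every compact
face (weighted Euler identity); in characteristic `p` they differ exactly on faces whose initial form has `w`-degree `≡ 0 (mod p)` — e.g. a lone vertex `z^p`, whose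
Jacobian vanishes identically (so every `z^p + …` bed of the F-half census FAILS `IsNewtonNondegenerate`) although `z^p ≠ 0` on the torus (so `WND` HOLDS there).
Ishii's proof of Lemma 4.4.24 (✓ p651264, res-L1-w45a-stub-1) produces, at a singular point `y` of the strict transform on the orbit over the origin, a torus point `x`
with `f_F(x) = 0` (4.13) AND `X_j ∂_j f_F (x) = 0` for all `j` (4.12 + unimodularity) — i.e. a TJURINA zero; so the lemma holds under `WND` along all positive weights.
* §1 `isWeaklyNondegenerateAlong_of_isNondegenerateAlong`,
  `weaklyNondegenerate_of_isNewtonNondegenerate` (NND ⇒ WND along every `w > 0`: the upgrade is a generalisation, the old theorems are corollaries);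
* §2 ★ `exists_eval_pderiv_ne_zero_of_weaklyNondegenerate` — WND along the integer weight `w > 0` and `f_F(q) = 0` at a `k`-rational torus point `q` ⇒ some
  `∂f_F/∂X_j (q) ≠ 0`;
* §3 ★★ `ishii_lemma_4_4_24_weak` — p651264 VERBATIM with `hND : IsNewtonNondegenerate ↑f` replaced by
  `hWND : ∀ w : Fin m → ℝ, (∀ i, 0 < w i) → IsWeaklyNondegenerateAlong w ↑f` (the last step now also feeds `h13 : f_F(x) = 0`); the Jacobian form
  p651264 is the special case NND ⇒ WND (not restated: `ishii_lemma_4_4_24_weak f (weaklyNondegenerate_of_isNewtonNondegenerate _ hND)`).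
Consumers: `…NewtonChartLemmaRegularWeak` / `…FHalfRowOfWeaklyNondegenerate` (this seat, (B)), `…CensusBedsWND` ((C): every census bed satisfies `hWND`).
[cite: IshiiSingularities2018, Lemma 4.4.24 (pp. 96–97)] [cite: BoubakriGreuelMarkwig2010, §3 (p. 10)]
-/

-- single-problem summit: the doubled namespace component is forced
set_option linter.dupNamespace false

noncomputable section

open MvPolynomial

namespace Summit.ResolutionOfSingularities.ResolutionOfSingularities.Theorems.FInjectiveMacaulayfication.NewtonChartLemma

open Literature.AlgebraicGeometry.Resolution Literature.AlgebraicGeometry.Resolution.BoubakriGreuelMarkwig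

variable {k : Type} [Field k] {m : ℕ}

/-! ## §1 NND ⇒ WND -/

/-- Non-degeneracy along `w` (Jacobian) implies WEAK non-degeneracy along `w` (Tjurina). [cite: BoubakriGreuelMarkwig2010, §3 (p. 10)] -/
theorem isWeaklyNondegenerateAlong_of_isNondegenerateAlong (w : Fin m → ℝ) (f : MvPowerSeries (Fin m) k) (h : IsNondegenerateAlong w f) :
    IsWeaklyNondegenerateAlong w f :=
  fun q hq hT => h q hq hT.2

/-- **NND ⇒ WND along every positive weight**: the Tjurina upgrade GENERALISES the Q8a/Q8c/Q8d theorems. [cite: BoubakriGreuelMarkwig2010, §3 (p. 10)] -/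
theorem weaklyNondegenerate_of_isNewtonNondegenerate (f : MvPowerSeries (Fin m) k) (hND : IsNewtonNondegenerate f) :
    ∀ w : Fin m → ℝ, (∀ i, 0 < w i) → IsWeaklyNondegenerateAlong w f :=
  fun w hw => isWeaklyNondegenerateAlong_of_isNondegenerateAlong w f (hND w hw)

/-! ## §2 Weak non-degeneracy in polynomial terms -/

/-- ★ **WEAK NON-DEGENERACY IN POLYNOMIAL TERMS**: if `f` is weakly non-degenerate along the positive integer weight `w` (Tjurina ideal of the face polynomial
`f_F = Σ_{α ∈ F} a_α X^α` without torus zeros), then at every `k`-rational torus point `q` WITH `f_F(q) = 0` SOME `∂f_F/∂X_j (q) ≠ 0`.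
[cite: BoubakriGreuelMarkwig2010, §3 (p. 10)] -/
theorem exists_eval_pderiv_ne_zero_of_weaklyNondegenerate (f : MvPolynomial (Fin m) k)
    (hWND : ∀ w : Fin m → ℝ, (∀ i, 0 < w i) → IsWeaklyNondegenerateAlong w (f : MvPowerSeries (Fin m) k))
    (w : Fin m → ℕ) (hw : ∀ i, 0 < w i) (F : Finset (Fin m →₀ ℕ))
    (hF : ∀ α, α ∈ F ↔ α ∈ f.support ∧ ∀ β ∈ f.support, ∑ j, w j * α j ≤ ∑ j, w j * β j)
    (q : Fin m → k) (hq : ∀ i, q i ≠ 0) (h0 : MvPolynomial.eval q (∑ α ∈ F, monomial α (coeff α f)) = 0) :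
    ∃ j : Fin m, MvPolynomial.eval q (pderiv j (∑ α ∈ F, monomial α (coeff α f))) ≠ 0 := by
  have h := hWND (fun i => (w i : ℝ)) (fun i => by exact_mod_cast hw i) q hq
  unfold IsTjurinaZero IsJacobianZero at h
  rw [initialForm_coe f w F hF] at h
  simp only [pderiv_coe, evalAt_coe] at h
  by_contra hcon
  push Not at hcon
  exact h ⟨h0, hcon⟩

/-! ## §3 ★★ Ishii's Lemma 4.4.24 under weak non-degeneracy -/

/-- ★★ **ISHII'S LEMMA 4.4.24, TJURINA VERSION (fan-free chart form, ANY field).** Let `f ∈ k[X_0,…,X_{m-1}]` be WEAKLY non-degenerate along every positive weight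
(BGM `IsWeaklyNondegenerateAlong w` for all `w > 0`: no torus point kills an initial form together with all its partials), `V` a UNIMODULAR exponent matrix with
`θ_V f = Y^e · g`, `g(0) ≠ 0` (the cone of `V` refines the dual Newton fan), and `S` a set of rows with strictly positive sum (the orbit `orb τ_S` lies over the origin).
Then at every `k`-point `y` of the orbit (`y_i = 0 ⟺ i ∈ S`): **`g(y) = 0 ⟹ ∃ i ∉ S, ∂g/∂Y_i (y) ≠ 0`.** Proof = p651264's (Ishii pp. 96–97): otherwise the torus point
`x_j = ∏_{i∉S} y_i^{V i j}` satisfies `f_F(x) = 0` (4.13) AND `V·u = 0` for `u_j = (X_j ∂_j f_F)(x)`, hence `u = 0` — a TJURINA zero of the face polynomial of the weight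
`Σ_{i∈S} row i`, contradicting weak non-degeneracy. In characteristic `p` this covers the `z^p + …` hypersurfaces that `IsNewtonNondegenerate` excludes.
[cite: IshiiSingularities2018, Lemma 4.4.24 (pp. 96–97)] [cite: BoubakriGreuelMarkwig2010, §3 (p. 10)] -/
theorem ishii_lemma_4_4_24_weak (f : MvPolynomial (Fin m) k)
    (hWND : ∀ w : Fin m → ℝ, (∀ i, 0 < w i) → IsWeaklyNondegenerateAlong w (f : MvPowerSeries (Fin m) k))
    (V : Matrix (Fin m) (Fin m) ℕ) (hV : IsUnit (V.map (Nat.cast : ℕ → ℤ)).det)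
    (e : Fin m →₀ ℕ) (g : MvPolynomial (Fin m) k) (hθ : aeval (fun j : Fin m => ∏ i : Fin m, (X i : MvPolynomial (Fin m) k) ^ V i j) f = monomial e 1 * g)
    (hg0 : constantCoeff g ≠ 0) (S : Finset (Fin m)) (hpos : ∀ j : Fin m, 0 < ∑ i ∈ S, V i j)
    (y : Fin m → k) (hy : ∀ i : Fin m, y i = 0 ↔ i ∈ S) (hgy : MvPolynomial.eval y g = 0) :
    ∃ i : Fin m, i ∉ S ∧ MvPolynomial.eval y (pderiv i g) ≠ 0 := by
  classical
  -- the exponent map, the torus point, the unit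
  set v : (Fin m →₀ ℕ) → (Fin m →₀ ℕ) := fun α => Finsupp.equivFunOnFinite.symm fun i => ∑ j, V i j * α j with hvdef
  have hv : ∀ α i, v α i = ∑ j, V i j * α j := fun α i => by simp [hvdef]
  set x : Fin m → k := fun j => ∏ i ∈ Sᶜ, y i ^ V i j with hxdef
  have hx : ∀ j, x j = ∏ i ∈ Sᶜ, y i ^ V i j := fun j => rfl
  set C : k := ∏ i ∈ Sᶜ, y i ^ e i with hCdef
  have hyT : ∀ i ∈ Sᶜ, y i ≠ 0 := fun i hi h0 => (Finset.mem_compl.mp hi) ((hy i).mp h0)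
  have hC0 : C ≠ 0 := Finset.prod_ne_zero_iff.mpr fun i hi => pow_ne_zero _ (hyT i hi)
  have hxT : ∀ j, x j ≠ 0 := fun j => Finset.prod_ne_zero_iff.mpr fun i hi => pow_ne_zero _ (hyT i hi)
  set F := f.support.filter (fun α => ∀ i ∈ S, v α i = e i) with hFdef
  by_contra hcon
  push Not at hcon
  -- (4.13): `f_F(x) = 0`
  have h13 : MvPolynomial.eval x (∑ α ∈ F, monomial α (coeff α f)) = 0 := by
    have h := C_mul_eval_g V hV f v hv e g hθ S y hy x hx C hCdef
    rw [hgy, mul_zero] at h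
    exact h.symm
  -- (4.12): `V · u = 0`
  have hW : ∀ l : Fin m, ∑ j, (V l j : k) * MvPolynomial.eval x (X j * pderiv j (∑ α ∈ F, monomial α (coeff α f))) = 0 := by
    intro l
    rw [sum_V_mul_u V f v hv F S y x hx l]
    by_cases hl : l ∈ S
    · rw [hFdef, W_of_mem V f v hv e S y x hx l hl, ← hFdef, h13, mul_zero]
    · have h := C_mul_mul_eval_pderiv_g V hV f v hv e g hθ S y hy x hx C hCdef l
      rw [hcon l hl, mul_zero, mul_zero, ← hFdef, h13, mul_zero, sub_zero] at h
      exact h.symm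
  have hu : (fun j => MvPolynomial.eval x (X j * pderiv j (∑ α ∈ F, monomial α (coeff α f)))) = 0 := by
    refine Matrix.eq_zero_of_mulVec_eq_zero (det_cast_ne_zero (k := k) V hV) ?_
    ext l
    rw [Matrix.mulVec, dotProduct, Pi.zero_apply]
    simpa [Matrix.map_apply] using hW l
  -- hence `x` is a TJURINA zero of `f_F` in the torus (`h13` ∧ `hu`): contradiction with WEAK non-degeneracy along the face of the weight `Σ_{i∈S} row i`
  obtain ⟨j, hj⟩ := exists_eval_pderiv_ne_zero_of_weaklyNondegenerate f hWND (fun j => ∑ i ∈ S, V i j) hpos F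
    (fun α => by rw [hFdef]; exact mem_face_iff V hV f v hv e g hθ hg0 S α) x hxT h13
  apply hj
  have hju := congr_fun hu j
  rw [Pi.zero_apply, map_mul, eval_X] at hju
  exact (mul_eq_zero.mp hju).resolve_left (hxT j)

end Summit.ResolutionOfSingularities.ResolutionOfSingularities.Theorems.FInjectiveMacaulayfication.NewtonChartLemma

end
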